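import Literature.Computability.AlgebraicComplexity.BorderRankMatMulThreeBlocks
import HarnessLib

/-!
# Borel-fixed `(110)`-candidates of `⟨3,3,3⟩`, II: block models and the covering theorem

Topic `Literature/Computability/AlgebraicComplexity`. Sequel of `BorderRankMatMulThreeBlocks.lean`
(block coordinates `blk j k i i'`, admissible subspaces `IsAdmissible`, `rootSet`, `diagSub`). Here:

* `MatMul3.DType`, `MatMul3.dtypeOf R δ`, `MatMul3.dmodel` — the possible diagonal parts of a
  Borel-stable block of `𝔤𝔩₃ ∋ Id` with root positions `R` and `δ + 1 = dim` of the diagonal part: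
  the identity line (`δ = 0`); for `δ = 1` the plane `⟨Id, e₀ - e₁⟩` or `⟨Id, e₁ - e₂⟩` forced by a
  negative root, `⟨Id, e₀⟩` or `⟨Id, e₂⟩` forced by a missing simple positive root, or else the
  FREE plane `⟨Id, d⟩` (CHL 2023, §6: "the weight zero subspace of `𝔰𝔩₃` has dimension two, so there
  are `𝔹`-fixed spaces … in positive dimensional families"); all diagonals (`δ = 2`);
* `MatMul3.blockModel`, `MatMul3.model` — the model subspace of a profile
  `(R_{jk}, δ_{jk}, d_{jk})_{jk}`;
* `MatMul3.IsAdmissible.le_model` — **covering theorem**: an admissible `E` lies in the model of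
  its own profile `(rootSet E, dim diagSub E - 1, a chosen diagonal)`;
* `MatMul3.IsAdmissible.blockOK`, `…mono…`, `…budget` — the profile satisfies the decidable
  constraints (`MatMul3.BlockOK`: off-diagonal, upper-set closure, negative roots force coroots,
  missing simple roots cut the diagonal; monotone along rows and columns; `∑ (|R| + δ) ≤ 7`) that
  make the Borel-fixed candidates a finite list.

All PROVED; pure linear algebra over a field.

## References

* A. Conner, A. Harper, J. M. Landsberg, *New lower bounds for matrix multiplication and `det₃`*,
  Forum Math. Pi 11 (2023) e17, arXiv:1911.07981 — §2.5, §6. [ConnerHarperLandsberg2023]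
-/

noncomputable section

open scoped BigOperators

namespace Literature.Computability.AlgebraicComplexity

namespace BorderApolarity

namespace MatMul3

universe u

variable {K : Type u} [Field K]

/-! ## Diagonal types and block models -/

/-- The seven kinds of diagonal part of a Borel-stable block of `𝔤𝔩₃` containing the identity.
[cite: ConnerHarperLandsberg2023, §6] -/
inductive DType
  | id | e0 | e2 | c01 | c12 | free | all
  deriving DecidableEq, Repr

/-- The diagonal type forced by the root positions `R` and `δ = dim - 1`.
[cite: ConnerHarperLandsberg2023, §6] -/
def dtypeOf (R : Finset (Fin 3 × Fin 3)) (δ : ℕ) : DType :=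
  if δ = 0 then .id else if 2 ≤ δ then .all else if ((1 : Fin 3), (0 : Fin 3)) ∈ R then .c01
  else if ((2 : Fin 3), (1 : Fin 3)) ∈ R then .c12 else if ((1 : Fin 3), (2 : Fin 3)) ∉ R then .e0
  else if ((0 : Fin 3), (1 : Fin 3)) ∉ R then .e2 else .free

/-- Generators of the diagonal model of each type (`d` is used by the free type only).
[cite: ConnerHarperLandsberg2023, §6] -/
def dgens (t : DType) (d : Fin 3 → K) : Set (Fin 3 → K) :=
  match t with
  | .id => {fun _ => 1}
  | .e0 => {fun _ => 1, Pi.single 0 1}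
  | .e2 => {fun _ => 1, Pi.single 2 1}
  | .c01 => {fun _ => 1, Pi.single 0 1 - Pi.single 1 1}
  | .c12 => {fun _ => 1, Pi.single 1 1 - Pi.single 2 1}
  | .free => {fun _ => 1, d}
  | .all => Set.univ

/-- The diagonal model of a type. [cite: ConnerHarperLandsberg2023, §6] -/
def dmodel (t : DType) (d : Fin 3 → K) : Submodule K (Fin 3 → K) := Submodule.span K (dgens t d)

/-- **The model block** of root positions `R`, diagonal dimension `δ + 1` and free diagonal `d`:
root units at `R` plus the diagonal model. [cite: ConnerHarperLandsberg2023, §6] -/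
def blockModel (j k : Fin 3) (R : Finset (Fin 3 × Fin 3)) (δ : ℕ) (d : Fin 3 → K) :
    Submodule K (I9' × I9' → K) :=
  Submodule.span K ((fun ii' : Fin 3 × Fin 3 => unitVec (K := K) j k ii'.1 ii'.2) '' (R : Set _)) ⊔
    (dmodel (dtypeOf R δ) d).map (diagVecLin j k)

/-- **The model** of a profile: the sum of its model blocks. [cite: ConnerHarperLandsberg2023, §6] -/
def model (Rf : Fin 3 × Fin 3 → Finset (Fin 3 × Fin 3)) (δf : Fin 3 × Fin 3 → ℕ)
    (df : Fin 3 × Fin 3 → Fin 3 → K) : Submodule K (I9' × I9' → K) :=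
  ⨆ jk : Fin 3 × Fin 3, blockModel jk.1 jk.2 (Rf jk) (δf jk) (df jk)

/-! ## The profile of a subspace -/

/-- `δ(E)_{jk} = dim (diagSub E j k) - 1`. [cite: ConnerHarperLandsberg2023, §6] -/
def δOf (E : Submodule K (I9' × I9' → K)) (jk : Fin 3 × Fin 3) : ℕ :=
  Module.finrank K (diagSub E jk.1 jk.2) - 1

open Classical in
/-- A diagonal of block `(j,k)` in `E` off the identity line, if there is one (else `0`).
[cite: ConnerHarperLandsberg2023, §6] -/
def dOf (E : Submodule K (I9' × I9' → K)) (jk : Fin 3 × Fin 3) : Fin 3 → K :=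
  if h : ∃ d ∈ diagSub E jk.1 jk.2, d ∉ Submodule.span K ({fun _ => (1 : K)} : Set (Fin 3 → K))
  then h.choose else 0

/-- The constants line has dimension `1`. [folklore] -/
theorem finrank_span_one : Module.finrank K (Submodule.span K ({fun _ => (1 : K)} : Set (Fin 3 → K))) = 1 :=
  finrank_span_singleton (by
    intro h
    have := congr_fun h 0
    simp at this)

/-- A plane `⟨1, v⟩` with `v` off the constants has dimension `2`. [folklore] -/
theorem finrank_span_pair {v : Fin 3 → K}
    (hv : v ∉ Submodule.span K ({fun _ => (1 : K)} : Set (Fin 3 → K))) :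
    Module.finrank K (Submodule.span K ({(fun _ => (1 : K)), v} : Set (Fin 3 → K))) = 2 := by
  have hli : LinearIndependent K ![(fun _ => (1 : K) : Fin 3 → K), v] := by
    rw [LinearIndependent.pair_iff]
    intro s t hst
    by_cases ht : t = 0
    · subst ht
      simp only [zero_smul, add_zero] at hst
      refine ⟨?_, rfl⟩
      have := congr_fun hst 0
      simpa using this
    · exfalso
      apply hv
      have : v = (-(s / t)) • (fun _ => (1 : K)) := by
        have h2 : t • v = -(s • fun _ => (1 : K)) := eq_neg_of_add_eq_zero_right hst
        have h3 : v = t⁻¹ • (t • v) := by rw [smul_smul, inv_mul_cancel₀ ht, one_smul]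
        rw [h3, h2, smul_neg, smul_smul, neg_smul, div_eq_inv_mul]
      rw [this]
      exact Submodule.smul_mem _ _ (Submodule.subset_span rfl)
  have h := finrank_span_eq_card hli
  have hr : Set.range ![(fun _ => (1 : K) : Fin 3 → K), v] = {(fun _ => (1 : K)), v} := by
    ext w
    simp only [Set.mem_range, Set.mem_insert_iff, Set.mem_singleton_iff]
    constructor
    · rintro ⟨i, rfl⟩
      fin_cases i <;> simp
    · rintro (rfl | rfl)
      · exact ⟨0, rfl⟩
      · exact ⟨1, rfl⟩
  rw [hr] at h
  simpa using h

/-! ## The diagonal part lies in its model -/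

section Cover

variable [CharZero K] {E : Submodule K (I9' × I9' → K)} (hE : IsAdmissible E)
include hE

/-- The diagonal part of block `(j,k)` of an admissible `E` lies in the diagonal model of its type.
[cite: ConnerHarperLandsberg2023, §6] -/
theorem IsAdmissible.diagSub_le_dmodel (jk : Fin 3 × Fin 3) :
    diagSub E jk.1 jk.2 ≤ dmodel (dtypeOf (rootSet E jk.1 jk.2) (δOf E jk)) (dOf E jk) := by
  classical
  obtain ⟨j, k⟩ := jk
  have h1mem : (fun _ => (1 : K)) ∈ diagSub E j k := hE.one_mem_diagSub j k
  have hspan1 : Submodule.span K ({fun _ => (1 : K)} : Set (Fin 3 → K)) ≤ diagSub E j k :=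
    Submodule.span_le.2 (by simpa using h1mem)
  -- a plane through the constants inside `diagSub` of dimension `2` is all of it
  have plane : ∀ v : Fin 3 → K, v ∈ diagSub E j k →
      v ∉ Submodule.span K ({fun _ => (1 : K)} : Set (Fin 3 → K)) →
      Module.finrank K (diagSub E j k) = 2 →
      diagSub E j k ≤ Submodule.span K ({(fun _ => (1 : K)), v} : Set (Fin 3 → K)) := by
    intro v hv hv1 h2
    have hle : Submodule.span K ({(fun _ => (1 : K)), v} : Set (Fin 3 → K)) ≤ diagSub E j k :=
      Submodule.span_le.2 (by
        rintro w (rfl | rfl)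
        · exact h1mem
        · exact hv)
    exact (Submodule.eq_of_le_of_finrank_le hle (by rw [h2, finrank_span_pair hv1])).ge
  have hcoroot : ∀ p q : Fin 3, p ≠ q →
      (Pi.single p (1 : K) - Pi.single q 1 : Fin 3 → K) ∉
        Submodule.span K ({fun _ => (1 : K)} : Set (Fin 3 → K)) := by
    intro p q hpq hmem
    rw [Submodule.mem_span_singleton] at hmem
    obtain ⟨c, hc⟩ := hmem
    have ep := congr_fun hc p
    have eq := congr_fun hc q
    simp [hpq, hpq.symm] at ep eq
    rw [ep] at eq
    norm_num at eq
  unfold dtypeOf δOf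
  simp only
  by_cases h0 : Module.finrank K (diagSub E j k) - 1 = 0
  · -- `δ = 0`: the constants line
    rw [if_pos h0]
    intro d hd
    have hfin : Module.finrank K (diagSub E j k) ≤ 1 := by omega
    have heq := Submodule.eq_of_le_of_finrank_le hspan1 (by rw [finrank_span_one]; exact hfin)
    rw [dmodel, dgens, heq]
    exact hd
  rw [if_neg h0]
  by_cases h2 : 2 ≤ Module.finrank K (diagSub E j k) - 1
  · -- `δ ≥ 2`: everything
    rw [if_pos h2]
    intro d _
    rw [dmodel, dgens, Submodule.span_univ]
    trivial
  rw [if_neg h2]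
  have hfin : Module.finrank K (diagSub E j k) = 2 := by omega
  by_cases hc01 : ((1 : Fin 3), (0 : Fin 3)) ∈ rootSet E j k
  · -- negative root `(1,0)`: the coroot `e₀ - e₁`
    rw [if_pos hc01, dmodel, dgens]
    exact plane _ (hE.coroot_mem (p := 0) (q := 1) (by decide) hc01) (hcoroot 0 1 (by decide)) hfin
  rw [if_neg hc01]
  by_cases hc12 : ((2 : Fin 3), (1 : Fin 3)) ∈ rootSet E j k
  · -- negative root `(2,1)`: the coroot `e₁ - e₂`
    rw [if_pos hc12, dmodel, dgens]
    exact plane _ (hE.coroot_mem (p := 1) (q := 2) (by decide) hc12) (hcoroot 1 2 (by decide)) hfin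
  rw [if_neg hc12]
  by_cases he0 : ((1 : Fin 3), (2 : Fin 3)) ∈ rootSet E j k
  swap
  · -- `(1,2)` missing: `d₁ = d₂`, so `d = d₁ · 1 + (d₀ - d₁) e₀`
    rw [if_pos he0]
    intro d hd
    have h12 := hE.apply_eq_of_not_mem_rootSet (p := 1) (q := 2) (by decide) he0 hd
    have : d = d 1 • (fun _ => (1 : K)) + (d 0 - d 1) • Pi.single (0 : Fin 3) (1 : K) := by
      funext i
      fin_cases i <;> simp [h12]
    rw [dmodel, dgens, this]
    exact Submodule.add_mem _ (Submodule.smul_mem _ _ (Submodule.subset_span (by simp)))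
      (Submodule.smul_mem _ _ (Submodule.subset_span (by simp)))
  rw [if_neg (not_not.2 he0)]
  by_cases he2 : ((0 : Fin 3), (1 : Fin 3)) ∈ rootSet E j k
  swap
  · -- `(0,1)` missing: `d₀ = d₁`, so `d = d₀ · 1 + (d₂ - d₀) e₂`
    rw [if_pos he2]
    intro d hd
    have h01 := hE.apply_eq_of_not_mem_rootSet (p := 0) (q := 1) (by decide) he2 hd
    have : d = d 0 • (fun _ => (1 : K)) + (d 2 - d 0) • Pi.single (2 : Fin 3) (1 : K) := by
      funext i
      fin_cases i <;> simp [h01]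
    rw [dmodel, dgens, this]
    exact Submodule.add_mem _ (Submodule.smul_mem _ _ (Submodule.subset_span (by simp)))
      (Submodule.smul_mem _ _ (Submodule.subset_span (by simp)))
  rw [if_neg (not_not.2 he2)]
  -- free: the chosen diagonal spans with the constants
  have hex : ∃ d ∈ diagSub E j k, d ∉ Submodule.span K ({fun _ => (1 : K)} : Set (Fin 3 → K)) := by
    by_contra hall
    push Not at hall
    have hle : diagSub E j k ≤ Submodule.span K ({fun _ => (1 : K)} : Set (Fin 3 → K)) := hall
    have := Submodule.finrank_mono hle
    rw [finrank_span_one, hfin] at this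
    omega
  have hd : dOf E (j, k) = hex.choose := by
    unfold dOf
    rw [dif_pos hex]
  rw [dmodel, dgens, hd]
  exact plane _ hex.choose_spec.1 hex.choose_spec.2 hfin

omit [CharZero K] hE in
/-- The off-block-diagonal part of `x`. [folklore] -/
theorem sum_diagProj_apply (x : I9' × I9' → K) (c : I9' × I9') :
    (∑ jk : Fin 3 × Fin 3, diagProj jk.1 jk.2 x) c = if c.1.1 = c.2.1 then x c else 0 := by
  rw [Finset.sum_apply, Finset.sum_eq_single (c.2.2, c.1.2)]
  · simp only [diagProj, LinearMap.coe_mk, AddHom.coe_mk, true_and]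
  · intro jk _ hne
    simp only [diagProj, LinearMap.coe_mk, AddHom.coe_mk]
    rw [if_neg]
    rintro ⟨h1, h2, -⟩
    exact hne (Prod.ext h2.symm h1.symm)
  · intro h; exact absurd (Finset.mem_univ _) h

/-- **Covering theorem**: an admissible `E` lies in the model of its own profile.
[cite: ConnerHarperLandsberg2023, §6] -/
theorem IsAdmissible.le_model :
    E ≤ model (fun jk => rootSet E jk.1 jk.2) (δOf E) (dOf E) := by
  classical
  intro x hx
  -- split `x` into its block-diagonal parts and the rest
  set y := ∑ jk : Fin 3 × Fin 3, diagProj jk.1 jk.2 x with hy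
  have hxy : x = (x - y) + y := by abel
  rw [hxy]
  refine Submodule.add_mem _ ?_ (Submodule.sum_mem _ fun jk _ => ?_)
  · -- the rest is a sum of root coordinates, each in the model
    rw [← Finset.univ_sum_single (x - y)]
    refine Submodule.sum_mem _ fun c _ => ?_
    have hval : (x - y) c = if c.1.1 = c.2.1 then 0 else x c := by
      rw [Pi.sub_apply, hy, sum_diagProj_apply]
      split_ifs <;> ring
    by_cases hdiag : c.1.1 = c.2.1
    · rw [hval, if_pos hdiag, Pi.single_zero]
      exact Submodule.zero_mem _
    rw [hval, if_neg hdiag]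
    by_cases hx0 : x c = 0
    · rw [hx0, Pi.single_zero]; exact Submodule.zero_mem _
    -- an active root coordinate
    have hroot : (c.1.1, c.2.1) ∈ rootSet E c.2.2 c.1.2 :=
      hE.mem_rootSet_of_apply_ne_zero hx hdiag (by rw [blk_eta]; exact hx0)
    have hmem : (Pi.single c (x c) : I9' × I9' → K) ∈
        blockModel c.2.2 c.1.2 (rootSet E c.2.2 c.1.2) (δOf E (c.2.2, c.1.2)) (dOf E (c.2.2, c.1.2)) := by
      refine Submodule.mem_sup_left ?_
      have : (Pi.single c (x c) : I9' × I9' → K) = x c • unitVec (K := K) c.2.2 c.1.2 c.1.1 c.2.1 := by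
        rw [unitVec, blk_eta, ← Pi.single_smul', smul_eq_mul, mul_one]
      rw [this]
      exact Submodule.smul_mem _ _ (Submodule.subset_span ⟨(c.1.1, c.2.1), hroot, rfl⟩)
    exact (le_iSup (fun jk : Fin 3 × Fin 3 => blockModel jk.1 jk.2 (rootSet E jk.1 jk.2) (δOf E jk)
      (dOf E jk)) (c.2.2, c.1.2)) hmem
  · -- each block-diagonal part lies in the diagonal model of its block
    have hd : (fun i => x (blk jk.1 jk.2 i i)) ∈ diagSub E jk.1 jk.2 := by
      rw [mem_diagSub, ← diagProj_eq_diagVec]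
      exact hE.diag_mem _ _ x hx
    have hmem : diagProj jk.1 jk.2 x ∈
        blockModel jk.1 jk.2 (rootSet E jk.1 jk.2) (δOf E jk) (dOf E jk) := by
      refine Submodule.mem_sup_right ⟨_, hE.diagSub_le_dmodel jk hd, ?_⟩
      rw [diagProj_eq_diagVec]
      rfl
    exact (le_iSup (fun jk : Fin 3 × Fin 3 => blockModel jk.1 jk.2 (rootSet E jk.1 jk.2) (δOf E jk)
      (dOf E jk)) jk) hmem

end Cover

end MatMul3

end BorderApolarity

end Literature.Computability.AlgebraicComplexity

end
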